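import Summits.QuantumFields.YangMills.Theorems.FluctuationComparisonRegPrIntLS2BetaGapOrbitCaseBVolumeUniform
import HarnessLib

/-!
# (RG-K) THE ℤ₂ SEAM TWIST, XIII — THE v12-CANDIDATE ORGAN GAP♭∘ (`μ` AFTER THE BASE POINT; px17 g14 CERT 603780ac, = the conclusion of ✓`gapFlatOrganAt_five`) AT EVERY BLOCK SIZE `L`
# BY STRATUM: the case-B stratum is a TREE THEOREM at EVERY `L` (incl. `L = 3`), and GAP♭∘-at-`L` follows from its restrictions to the irreducible and the case-A strata

Helper for crux `stmt-QuantumFields-20520` (`Theses.UnitScaleTilt.FluctuationComparisonRegPrIntL`), the (T)-chain of LINE `semiclassical_s2beta` (cell `ym3-torus`, width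
seat «width 16» px16 g19).  ✓px17 g17 `…S2BetaGapFlatOrganFive.gapFlatOrganAt_five` proves the v12-candidate organ GAP♭∘ at every `L ≥ 5` with ZERO hypotheses, and its all-`L`
door (#3) reads GAP♭∘-at-`L` from four letters at `L` (POS∘, `hlift`, Prop 7 cl.1, the Thm-1 pair — hypotheses at `L = 3`, EMBARGO-LITE №58).  Parts IX (EXW∘, ✓`…WindowExactnessOfStrata`)
and XI–XII (GAP♯∘ as REGISTERED, ✓`…GapOrbitOfStrata` ∕ ✓`…GapOrbitCaseBVolumeUniform`) showed that on the CASE-B stratum («closed-walk holonomies of `V` central» — the flat datum, the seven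
non-trivial ℤ₂ seam sectors and their gauge orbits) the organs need NO analytic letter.  THIS file records the same for GAP♭∘-at-`L`, at EVERY `L`:

* §1 ★★★★ `gapFlatOrganAt_caseB (L : ℕ) : ⟨GAP♭∘-at-L text with the guard «∃ x₀, closed-walk holonomies of V at x₀ central» inserted after the datum guard⟩` — OUTRIGHT, EVERY `L`
  (✓part XII `gapOrbit_caseB_allDepths_volumeUniform` at `m := K − J`, its `μ(L, K−J)` serving as the organ's per-base-point `μ`; `θBal(cw·b₀) ≤ 2` by lit ✓`exists_gamma_forall_θBal_le`).
* §2 ★★★★ `gapFlatOrganAt_of_strata (L) (hIrr) (hA) : ⟨GAP♭∘-at-L⟩` — from the same text guarded by «IRR(V)» and by «case A′(V)» (✓`irr_or_caseA_or_loopHol_central`'s first two disjuncts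
  VERBATIM, as in parts IX∕XI∕XII); prefix threaded as in part IX (`c₀ := min`, `pS := max`, `ε₁ := min`, `γ₁ := min`; NO modulus merge — GAP♭∘ chooses `μ` after `U₀`).
  USE: the four `L = 3` letters of px17's all-`L` door are needed on IRR ∪ A′ only.

HONEST: quantifier plumbing over landed letters; nothing of Bałaban's analysis; the two strata hypotheses at `L < 5` (in particular `L = 3`) ARE the content of [Balaban1985Variational] Thm 1 ∕
Prop. 7 there (OPEN, №58); no registered stub is closed (the registry v11.4 keys GAP♯∘, not GAP♭∘; the re-key is the ideator's∕LEAD's verb); TUBE-REG∘, EXW∘ at `L = 3`, DET-REP-B, S2β,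
crux 20520 OPEN; rung R3 (YM₃ on T³) is NOT d = 4, NOT infinite volume, NOT a mass gap, NOT Clay; the Yang–Mills mass gap is NOT proved.
-/

set_option autoImplicit false

noncomputable section

open Set Function
open scoped Matrix.Norms.L2Operator
open Literature.MathematicalPhysics.QuantumFieldTheory.Balaban1983to89
open Literature.MathematicalPhysics.QuantumFieldTheory.Balaban1983to89.T4Continuum
open Literature.MathematicalPhysics.QuantumFieldTheory.Balaban1983to89.B10Eq27TorusAxialLog (unitsField toUField)
open Literature.MathematicalPhysics.QuantumFieldTheory.Balaban1983to89.B9AdOrthogonal (σ₃)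
open Literature.MathematicalPhysics.QuantumFieldTheory.Balaban1983to89.T3ContinuumYM3Torus
open Literature.MathematicalPhysics.QuantumFieldTheory.Balaban1983to89.T3UnitLawDensityEML (ℰp)
open Literature.MathematicalPhysics.QuantumFieldTheory.Balaban1983to89.T3UnitScaleTilt
open Literature.MathematicalPhysics.QuantumFieldTheory.Balaban1983to89.T3TiltDescent
open Literature.MathematicalPhysics.QuantumFieldTheory.Balaban1983to89.T3Thresholds (exists_gamma_forall_θBal_le)
open Literature.MathematicalPhysics.QuantumFieldTheory.Balaban1983to89.T3ConstrainedMinimiser (fibre)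
open Literature.MathematicalPhysics.QuantumFieldTheory.Balaban1983to89.T3PrintedRegularMinimiser
open Literature.MathematicalPhysics.QuantumFieldTheory.Balaban1983to89.T3PrintedRegularOrbits
open scoped Literature.MathematicalPhysics.QuantumFieldTheory.Balaban1983to89.T3OrbitAverage
open Summit.QuantumFields.YangMills.Theorems.FluctuationComparisonRegPrIntLS2BetaWindowStrataCaseB (irr_or_caseA_or_loopHol_central)
open Summit.QuantumFields.YangMills.Theorems.FluctuationComparisonRegPrIntLS2BetaGapOrbitCaseBVolumeUniform (gapOrbit_caseB_allDepths_volumeUniform)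

namespace Summit.QuantumFields.YangMills.Theorems.FluctuationComparisonRegPrIntLS2BetaGapFlatOrganOfStrata

/-! ## §1 GAP♭∘-at-`L` on the case-B stratum, every `L` -/

/-- ★★★★ **THE v12-CANDIDATE ORGAN GAP♭∘ AT BLOCK SIZE `L`, RESTRICTED TO THE CASE-B STRATUM, IS A TREE THEOREM FOR EVERY `L`** (incl. `L = 3`; px17 g14 CERT 603780ac text = the conclusion of
✓`gapFlatOrganAt_five`, with the guard «∃ x₀, closed-walk holonomies of `V` at `x₀` central» inserted after the datum guard).  ✓part XII at `m := K − J` supplies the per-base-point `μ`;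
the datum guard `PlaqSmall (θBal … (cw·b₀) … J) V` is turned into `PlaqSmall δ V`, `δ ≤ 2`, by lit ✓`exists_gamma_forall_θBal_le` at `σ := 2`.
[cite: Balaban1985Variational, (142) p.299, Thm 1 (8)-(10) p.279, Prop. 7 p.299, (4)-(6) p.278; Balaban1984PropagatorsII, (1.33); Balaban1985UV3, (7) p.257] -/
theorem gapFlatOrganAt_caseB (L : ℕ) :
    ∃ c₀ : ℝ, 0 < c₀ ∧ c₀ ≤ 1 ∧ ∀ (cw : ℝ), 0 < cw → cw ≤ c₀ → ∃ pS : ℝ, ∀ (b₀ p₀ : ℝ), 0 < b₀ → pS ≤ p₀ → 0 < p₀ →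
      ∃ ε₁ : ℝ, 0 < ε₁ ∧ ∀ (ε₀ : ℝ), 0 < ε₀ → ε₀ ≤ ε₁ →
      ∃ γ₁ : ℝ, 0 < γ₁ ∧ ∀ (F : T3Family) (γ : ℝ), F.L = L → 0 < γ → γ ≤ γ₁ →
        ∀ (J K : ℕ) (hJK : J ≤ K) (V : GaugeField (F.P J) 0 (Matrix.specialUnitaryGroup (Fin 2) ℂ)), PlaqSmall (θBal F.L γ (cw * b₀) p₀ J) V →
        (∃ x₀ : Site (F.P J) 0, ∀ w : List (Letter (F.P J).d), walkEnd x₀ w = x₀ →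
          ∀ M : Matrix (Fin 2) (Fin 2) ℂ, Commute ((holAt V (walk x₀ w) : Matrix.specialUnitaryGroup (Fin 2) ℂ) : Matrix (Fin 2) (Fin 2) ℂ) M) →
          ∀ U₀ ∈ {U' | U' ∈ fibre F ℰp J K hJK V ∧ U' ∈ histGood F ℰp (θBal F.L γ b₀ p₀) K J ∧
              wilsonAction4 U' = minActionRegPr F J K hJK ε₀ V}, ∃ μ : ℝ, 0 < μ ∧
            ∀ U ∈ fibre F ℰp J K hJK V, U ∈ histGood F ℰp (θBal F.L γ b₀ p₀) K J →
              μ * ((F.L : ℝ)⁻¹) ^ (2 * (K - J)) *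
                  (⨅ w : {w : Site (F.P K) 0 → Matrix.specialUnitaryGroup (Fin 2) ℂ |
                      ∀ U : GaugeField (F.P K) 0 (Matrix.specialUnitaryGroup (Fin 2) ℂ),
                        descendTo F ℰp J K hJK (GaugeField.gaugeAct w U) = descendTo F ℰp J K hJK U},
                    ∑ ℓ : PBond (F.P K) 0,
                      dist1 (U ℓ * ((GaugeField.gaugeAct (w : Site (F.P K) 0 → Matrix.specialUnitaryGroup (Fin 2) ℂ) U₀) ℓ)⁻¹) ^ 2)
                ≤ wilsonAction4 U - minActionRegPr F J K hJK ε₀ V := by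
  refine ⟨1, one_pos, le_rfl, fun cw hcw _ => ⟨0, fun b₀ p₀ hb _ hp => ⟨1, one_pos, fun ε₀ hε₀ _ => ?_⟩⟩⟩
  obtain ⟨γd, hγd, H⟩ := gapOrbit_caseB_allDepths_volumeUniform L b₀ p₀ hb hp
  obtain ⟨γc, hγc, -, hθ⟩ := exists_gamma_forall_θBal_le (b₀ := cw * b₀) (p₀ := p₀) (mul_pos hcw hb) hp (σ := 2) two_pos
  refine ⟨min γd γc, lt_min hγd hγc, ?_⟩
  intro F γ hFL hγ hγle J K hJK V hV hB U₀ hU₀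
  obtain ⟨x₀, hcen⟩ := hB
  obtain ⟨μ, hμ, Hm⟩ := H (K - J)
  refine ⟨μ, hμ, ?_⟩
  intro U hU hUg
  have h2 : θBal F.L γ (cw * b₀) p₀ J ≤ 2 := hθ F.L F.hL.2.le γ hγ (hγle.trans (min_le_right _ _)) J
  exact Hm F γ hFL hγ (hγle.trans (min_le_left _ _)) J K hJK rfl ε₀ hε₀ V x₀ hcen _ h2 hV U₀ hU₀ U hU hUg

/-! ## §2 GAP♭∘-at-`L` from its two analytic strata -/

/-- ★★★★ **GAP♭∘-at-`L` ⟸ ITS RESTRICTIONS TO THE IRREDUCIBLE AND THE CASE-A STRATA** (hypotheses: the organ text at `L` with the guard «IRR(V)», resp. «case A′(V)», inserted after the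
datum guard — ✓`irr_or_caseA_or_loopHol_central`'s first two disjuncts VERBATIM; case B by §1; prefix threaded as in part IX, no modulus merge).
[cite: Balaban1985Variational, (142) p.299, Thm 1 (8)-(10) p.279, Prop. 7 p.299, (4)-(6) p.278; Balaban1985UV3, (7) p.257] -/
theorem gapFlatOrganAt_of_strata (L : ℕ)
    (hIrr : ∃ c₀ : ℝ, 0 < c₀ ∧ c₀ ≤ 1 ∧ ∀ (cw : ℝ), 0 < cw → cw ≤ c₀ → ∃ pS : ℝ, ∀ (b₀ p₀ : ℝ), 0 < b₀ → pS ≤ p₀ → 0 < p₀ →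
      ∃ ε₁ : ℝ, 0 < ε₁ ∧ ∀ (ε₀ : ℝ), 0 < ε₀ → ε₀ ≤ ε₁ →
      ∃ γ₁ : ℝ, 0 < γ₁ ∧ ∀ (F : T3Family) (γ : ℝ), F.L = L → 0 < γ → γ ≤ γ₁ →
        ∀ (J K : ℕ) (hJK : J ≤ K) (V : GaugeField (F.P J) 0 (Matrix.specialUnitaryGroup (Fin 2) ℂ)), PlaqSmall (θBal F.L γ (cw * b₀) p₀ J) V →
        (∀ c : Site (F.P J) 0 → Matrix (Fin 2) (Fin 2) ℂ,
          (∀ e : PBond (F.P J) 0, c e.src = ((unitsField (toUField V) e : (Matrix (Fin 2) (Fin 2) ℂ)ˣ) : Matrix (Fin 2) (Fin 2) ℂ) * c e.tgt *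
            (((unitsField (toUField V) e)⁻¹ : (Matrix (Fin 2) (Fin 2) ℂ)ˣ) : Matrix (Fin 2) (Fin 2) ℂ)) →
          ∃ z : ℂ, ∀ y, c y = z • (1 : Matrix (Fin 2) (Fin 2) ℂ)) →
          ∀ U₀ ∈ {U' | U' ∈ fibre F ℰp J K hJK V ∧ U' ∈ histGood F ℰp (θBal F.L γ b₀ p₀) K J ∧
              wilsonAction4 U' = minActionRegPr F J K hJK ε₀ V}, ∃ μ : ℝ, 0 < μ ∧
            ∀ U ∈ fibre F ℰp J K hJK V, U ∈ histGood F ℰp (θBal F.L γ b₀ p₀) K J →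
              μ * ((F.L : ℝ)⁻¹) ^ (2 * (K - J)) *
                  (⨅ w : {w : Site (F.P K) 0 → Matrix.specialUnitaryGroup (Fin 2) ℂ |
                      ∀ U : GaugeField (F.P K) 0 (Matrix.specialUnitaryGroup (Fin 2) ℂ),
                        descendTo F ℰp J K hJK (GaugeField.gaugeAct w U) = descendTo F ℰp J K hJK U},
                    ∑ ℓ : PBond (F.P K) 0,
                      dist1 (U ℓ * ((GaugeField.gaugeAct (w : Site (F.P K) 0 → Matrix.specialUnitaryGroup (Fin 2) ℂ) U₀) ℓ)⁻¹) ^ 2)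
                ≤ wilsonAction4 U - minActionRegPr F J K hJK ε₀ V)
    (hA : ∃ c₀ : ℝ, 0 < c₀ ∧ c₀ ≤ 1 ∧ ∀ (cw : ℝ), 0 < cw → cw ≤ c₀ → ∃ pS : ℝ, ∀ (b₀ p₀ : ℝ), 0 < b₀ → pS ≤ p₀ → 0 < p₀ →
      ∃ ε₁ : ℝ, 0 < ε₁ ∧ ∀ (ε₀ : ℝ), 0 < ε₀ → ε₀ ≤ ε₁ →
      ∃ γ₁ : ℝ, 0 < γ₁ ∧ ∀ (F : T3Family) (γ : ℝ), F.L = L → 0 < γ → γ ≤ γ₁ →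
        ∀ (J K : ℕ) (hJK : J ≤ K) (V : GaugeField (F.P J) 0 (Matrix.specialUnitaryGroup (Fin 2) ℂ)), PlaqSmall (θBal F.L γ (cw * b₀) p₀ J) V →
        (∃ g : GaugeTransf (F.P J) 0 (Matrix.specialUnitaryGroup (Fin 2) ℂ),
          (∀ e : PBond (F.P J) 0, Commute (((GaugeField.gaugeAct g V) e : Matrix.specialUnitaryGroup (Fin 2) ℂ) : Matrix (Fin 2) (Fin 2) ℂ) σ₃) ∧
          ∀ c : Site (F.P J) 0 → Matrix (Fin 2) (Fin 2) ℂ,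
            (∀ e : PBond (F.P J) 0, c e.src = ((unitsField (toUField (GaugeField.gaugeAct g V)) e : (Matrix (Fin 2) (Fin 2) ℂ)ˣ) : Matrix (Fin 2) (Fin 2) ℂ) * c e.tgt *
            (((unitsField (toUField (GaugeField.gaugeAct g V)) e)⁻¹ : (Matrix (Fin 2) (Fin 2) ℂ)ˣ) : Matrix (Fin 2) (Fin 2) ℂ)) →
            ∃ c₀ : Matrix (Fin 2) (Fin 2) ℂ, (∀ y, c y = c₀) ∧ Commute c₀ σ₃) →
          ∀ U₀ ∈ {U' | U' ∈ fibre F ℰp J K hJK V ∧ U' ∈ histGood F ℰp (θBal F.L γ b₀ p₀) K J ∧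
              wilsonAction4 U' = minActionRegPr F J K hJK ε₀ V}, ∃ μ : ℝ, 0 < μ ∧
            ∀ U ∈ fibre F ℰp J K hJK V, U ∈ histGood F ℰp (θBal F.L γ b₀ p₀) K J →
              μ * ((F.L : ℝ)⁻¹) ^ (2 * (K - J)) *
                  (⨅ w : {w : Site (F.P K) 0 → Matrix.specialUnitaryGroup (Fin 2) ℂ |
                      ∀ U : GaugeField (F.P K) 0 (Matrix.specialUnitaryGroup (Fin 2) ℂ),
                        descendTo F ℰp J K hJK (GaugeField.gaugeAct w U) = descendTo F ℰp J K hJK U},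
                    ∑ ℓ : PBond (F.P K) 0,
                      dist1 (U ℓ * ((GaugeField.gaugeAct (w : Site (F.P K) 0 → Matrix.specialUnitaryGroup (Fin 2) ℂ) U₀) ℓ)⁻¹) ^ 2)
                ≤ wilsonAction4 U - minActionRegPr F J K hJK ε₀ V) :
    ∃ c₀ : ℝ, 0 < c₀ ∧ c₀ ≤ 1 ∧ ∀ (cw : ℝ), 0 < cw → cw ≤ c₀ → ∃ pS : ℝ, ∀ (b₀ p₀ : ℝ), 0 < b₀ → pS ≤ p₀ → 0 < p₀ →
      ∃ ε₁ : ℝ, 0 < ε₁ ∧ ∀ (ε₀ : ℝ), 0 < ε₀ → ε₀ ≤ ε₁ →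
      ∃ γ₁ : ℝ, 0 < γ₁ ∧ ∀ (F : T3Family) (γ : ℝ), F.L = L → 0 < γ → γ ≤ γ₁ →
        ∀ (J K : ℕ) (hJK : J ≤ K) (V : GaugeField (F.P J) 0 (Matrix.specialUnitaryGroup (Fin 2) ℂ)), PlaqSmall (θBal F.L γ (cw * b₀) p₀ J) V →
          ∀ U₀ ∈ {U' | U' ∈ fibre F ℰp J K hJK V ∧ U' ∈ histGood F ℰp (θBal F.L γ b₀ p₀) K J ∧
              wilsonAction4 U' = minActionRegPr F J K hJK ε₀ V}, ∃ μ : ℝ, 0 < μ ∧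
            ∀ U ∈ fibre F ℰp J K hJK V, U ∈ histGood F ℰp (θBal F.L γ b₀ p₀) K J →
              μ * ((F.L : ℝ)⁻¹) ^ (2 * (K - J)) *
                  (⨅ w : {w : Site (F.P K) 0 → Matrix.specialUnitaryGroup (Fin 2) ℂ |
                      ∀ U : GaugeField (F.P K) 0 (Matrix.specialUnitaryGroup (Fin 2) ℂ),
                        descendTo F ℰp J K hJK (GaugeField.gaugeAct w U) = descendTo F ℰp J K hJK U},
                    ∑ ℓ : PBond (F.P K) 0,
                      dist1 (U ℓ * ((GaugeField.gaugeAct (w : Site (F.P K) 0 → Matrix.specialUnitaryGroup (Fin 2) ℂ) U₀) ℓ)⁻¹) ^ 2)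
                ≤ wilsonAction4 U - minActionRegPr F J K hJK ε₀ V := by
  obtain ⟨c₁, hc₁, hc₁1, H1⟩ := hIrr
  obtain ⟨c₂, hc₂, -, H2⟩ := hA
  obtain ⟨c₃, hc₃, -, H3⟩ := gapFlatOrganAt_caseB L
  refine ⟨min c₁ (min c₂ c₃), lt_min hc₁ (lt_min hc₂ hc₃), (min_le_left _ _).trans hc₁1, ?_⟩
  intro cw hcw hcwle
  obtain ⟨pS₁, H1⟩ := H1 cw hcw (hcwle.trans (min_le_left _ _))
  obtain ⟨pS₂, H2⟩ := H2 cw hcw (hcwle.trans ((min_le_right _ _).trans (min_le_left _ _)))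
  obtain ⟨pS₃, H3⟩ := H3 cw hcw (hcwle.trans ((min_le_right _ _).trans (min_le_right _ _)))
  refine ⟨max pS₁ (max pS₂ pS₃), ?_⟩
  intro b₀ p₀ hb hpS hp
  obtain ⟨e₁, he₁, H1⟩ := H1 b₀ p₀ hb ((le_max_left _ _).trans hpS) hp
  obtain ⟨e₂, he₂, H2⟩ := H2 b₀ p₀ hb (((le_max_left _ _).trans (le_max_right _ _)).trans hpS) hp
  obtain ⟨e₃, he₃, H3⟩ := H3 b₀ p₀ hb (((le_max_right _ _).trans (le_max_right _ _)).trans hpS) hp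
  refine ⟨min e₁ (min e₂ e₃), lt_min he₁ (lt_min he₂ he₃), ?_⟩
  intro ε₀ hε₀ hε₀le
  obtain ⟨γa, hγa, H1⟩ := H1 ε₀ hε₀ (hε₀le.trans (min_le_left _ _))
  obtain ⟨γb, hγb, H2⟩ := H2 ε₀ hε₀ (hε₀le.trans ((min_le_right _ _).trans (min_le_left _ _)))
  obtain ⟨γd, hγd, H3⟩ := H3 ε₀ hε₀ (hε₀le.trans ((min_le_right _ _).trans (min_le_right _ _)))
  refine ⟨min γa (min γb γd), lt_min hγa (lt_min hγb hγd), ?_⟩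
  intro F γ hFL hγ hγle J K hJK V hV U₀ hU₀
  rcases irr_or_caseA_or_loopHol_central V with hirr | hcA | hcB
  · exact H1 F γ hFL hγ (hγle.trans (min_le_left _ _)) J K hJK V hV hirr U₀ hU₀
  · exact H2 F γ hFL hγ (hγle.trans ((min_le_right _ _).trans (min_le_left _ _))) J K hJK V hV hcA U₀ hU₀
  · exact H3 F γ hFL hγ (hγle.trans ((min_le_right _ _).trans (min_le_right _ _))) J K hJK V hV hcB U₀ hU₀

end Summit.QuantumFields.YangMills.Theorems.FluctuationComparisonRegPrIntLS2BetaGapFlatOrganOfStrata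

end
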